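import Summits.ResolutionOfSingularities.ResolutionOfSingularities.Theorems.FrobeniusClosingSteerResonanceAlternative
import Literature.AlgebraicGeometry.Resolution.QuadraticTransformsRegular
import Literature.AlgebraicGeometry.Resolution.QuadraticTransformsUFD
import Mathlib.RingTheory.DiscreteValuationRing.Basic
import HarnessLib

/-!
# Steer core, NSCᴹ line, L5 `ResonanceAlternative` WITHOUT the dimension proviso: the DEGENERATE TAIL of a point sequence
# (a member of dimension `≤ 1` is a DVR, the sequence stops there, and every element of the Shannon extension is near) — PROOFS

OURS (campaign `res-hironaka`, rung L, slot W4.1, crux `Steer` stmt-ResolutionOfSingularities-16345, idea-2 card 3 r3 support L5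
`ResonanceAlternative`, Sketch-idea-2f 64403cb98dc5de30 l.852; res-type-058 gen 8, follow-up (β) to p518428). Companion of
`FrobeniusClosingSteerResonanceAlternative.lean` (p518428), which proves L5's conclusion from the named fact
`HeinzerEtAl2015NoetherianHullUFD` (p517055) under the EXTRA binder «every member has Krull dimension `≥ 2`» (HLOST Setting 3.1).
This file removes that binder: if some member `R i` of a point sequence along `O` (regular local rings, each the quadratic transform of the
previous one along `O`) has dimension `≤ 1`, then `R i` is a discrete valuation ring dominated by `O`, its quadratic transform along `O`
is `R i` itself (`eq_of_isQuadraticTransformAlong_of_isPrincipalIdealRing`), the sequence is constant from `i` on, the Shannon extension IS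
`R i`, and every non-zero element of it divides a power of the hull parameter `x` — i.e. is NEAR; so no far element exists and L5 holds
vacuously there. NOT a statement of the manuscript under review [claim: Hironaka2017, status: under-review]; AI-produced, weaker than
expert review. Theses-free, Cruxes-free, definition-free; `--supports stmt-ResolutionOfSingularities-16345 --as helper`. Still CONDITIONAL
on `HeinzerEtAl2015NoetherianHullUFD` in the generic case (`proof.conditional`; res-L0-w41-stub-4 discharges the fact, RULING 39a).

Main theorem: `resonanceAlternative_of_noetherianHullUFD` — L5's data and conclusion verbatim (vocabulary unfolded as in p518428),
without `hdim2` and without the unused L5 binders `A₀.FG` / `¬ dim ≤ 2` / `¬ StronglySwitching` (adoption leaf: `fun … => by exact …`).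
-/

noncomputable section

set_option linter.dupNamespace false -- mandated namespace of this single-conjunct summit
set_option autoImplicit false

namespace Summit.ResolutionOfSingularities.ResolutionOfSingularities.Theorems.SwitchingDichotomy.Resonance

open Literature.AlgebraicGeometry.Resolution
open IsLocalRing

section Tail

variable {K : Type} [Field K] {O : ValuationSubring K}

/-- In the value group: `v ≠ 0` and `v⁻¹ ≤ 1` give `1 ≤ v`. [folklore] -/
theorem one_le_of_inv_le_one_valueGroup {v : O.ValueGroup} (hv : v ≠ 0) (h : v⁻¹ ≤ 1) : 1 ≤ v :=
  (inv_le_one₀ (zero_lt_iff.mpr hv)).mp h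

/-- A unit of a subring `R ≤ O` has `O`-value `1`. [folklore] -/
theorem valuation_eq_one_of_isUnit {R : Subring K} (hRO : R ≤ O.toSubring) {u : R} (hu : IsUnit u) :
    O.valuation (u : K) = 1 := by
  obtain ⟨hu0, hinv⟩ := (isUnit_subring_iff_inv_mem u).mp hu
  have h1 : O.valuation (u : K) ≤ 1 := (O.valuation_le_one_iff _).mpr (hRO u.2)
  have h2 : O.valuation (u : K)⁻¹ ≤ 1 := (O.valuation_le_one_iff _).mpr (hRO hinv)
  rw [map_inv₀] at h2
  exact le_antisymm h1 (one_le_of_inv_le_one_valueGroup ((Valuation.ne_zero_iff _).mpr hu0) h2)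

/-- For a local subring `R` dominated by `O`, `locAtCentre R O = R` (every element of value `1` in `R` is a unit of `R`). [folklore] -/
theorem locAtCentre_eq_self_of_dominates {R : Subring K} [IsLocalRing R] (hdom : SubringDominates R O.toSubring) :
    locAtCentre R O = R := by
  refine le_antisymm ?_ (le_locAtCentre R O)
  intro t ht
  obtain ⟨y, hy, z, hz, hvz, rfl⟩ := mem_locAtCentre_iff.mp ht
  have hzinvO : z⁻¹ ∈ O := by rw [← O.valuation_le_one_iff, map_inv₀, hvz, inv_one]
  have hzinvR : z⁻¹ ∈ R := hdom.2 z hz hzinvO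
  rw [div_eq_mul_inv]
  exact R.mul_mem hy hzinvR

/-- **The degenerate quadratic transform.** If `R ≤ O` is a local principal ideal domain dominated by `O` (a DVR; a field has no quadratic
transform at all), then its quadratic transform along `O` is `R` itself: the generator of minimal value of `𝔪_R` divides every element of
`𝔪_R`, so `R[𝔪/x] = R`, and `R_{𝔪_O ∩ R} = R`. [folklore] -/
theorem eq_of_isQuadraticTransformAlong_of_isPrincipalIdealRing {R R₁ : Subring K} [IsLocalRing R]
    (hPIR : IsPrincipalIdealRing R) (hdom : SubringDominates R O.toSubring) (h : IsQuadraticTransformAlong O R R₁) :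
    R₁ = R := by
  classical
  have hRO : R ≤ O.toSubring := h.source_le
  obtain ⟨hloc', x, hxm, hx0, hmax, hR₁⟩ := h.exists_eq_locAtCentre
  -- `R` is a DVR
  haveI : IsDiscreteValuationRing R :=
    { toIsPrincipalIdealRing := hPIR
      toIsLocalRing := ‹_›
      not_a_field' := fun hbot => hx0 (by
        have : x ∈ (⊥ : Ideal R) := hbot ▸ hxm
        exact (Submodule.mem_bot R).mp this) }
  obtain ⟨ϖ, hϖ⟩ := IsDiscreteValuationRing.exists_irreducible R
  have hϖm : ϖ ∈ maximalIdeal R := hϖ.not_isUnit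
  have hvϖ : O.valuation (ϖ : K) < 1 := ((subringDominates_valuationSubring_iff hRO).mp hdom ϖ).mp hϖm
  have hvϖ0 : 0 < O.valuation (ϖ : K) := (Valuation.pos_iff _).mpr (fun h0 => hϖ.ne_zero (Subtype.ext h0))
  have hval_assoc : ∀ {y : R} {n : ℕ}, Associated y (ϖ ^ n) → O.valuation (y : K) = O.valuation (ϖ : K) ^ n := by
    intro y n hyn
    obtain ⟨u, hu⟩ := hyn.symm
    rw [← hu, Subring.coe_mul, map_mul, SubmonoidClass.coe_pow, map_pow, valuation_eq_one_of_isUnit hRO u.isUnit, mul_one]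
  -- `x` divides every element of `𝔪_R`
  obtain ⟨b, hxb⟩ := IsDiscreteValuationRing.associated_pow_irreducible hx0 hϖ
  have hxK : (x : K) ≠ 0 := fun h0 => hx0 (Subtype.ext h0)
  have hdiv : ∀ y ∈ maximalIdeal R, (y : K) / x ∈ R := by
    intro y hy
    by_cases hy0 : y = 0
    · rw [hy0, ZeroMemClass.coe_zero, zero_div]; exact R.zero_mem
    obtain ⟨a, hya⟩ := IsDiscreteValuationRing.associated_pow_irreducible hy0 hϖ
    have hba : b ≤ a := by
      by_contra hlt
      rw [not_le] at hlt
      have h1 := hmax y hy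
      rw [hval_assoc hya, hval_assoc hxb] at h1
      exact absurd (pow_lt_pow_right_of_lt_one₀ hvϖ0 hvϖ hlt) (not_lt.mpr h1)
    obtain ⟨u₁, hu₁⟩ := hxb.symm
    obtain ⟨u₂, hu₂⟩ := hya.symm
    let c : R := ϖ ^ (a - b) * (u₂ : R) * (↑u₁⁻¹ : R)
    have hyc : y = x * c := by
      rw [← hu₂, ← hu₁]
      have hU : (u₁ : R) * (↑u₁⁻¹ : R) = 1 := Units.mul_inv u₁
      have hpow : ϖ ^ a = ϖ ^ b * ϖ ^ (a - b) := by rw [← pow_add, Nat.add_sub_cancel' hba]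
      rw [hpow]
      linear_combination (-(ϖ ^ b * ϖ ^ (a - b) * (u₂ : R))) * hU
    have hq : (y : K) / x = (c : K) := by
      rw [div_eq_iff hxK, hyc, Subring.coe_mul, mul_comm]
    rw [hq]; exact c.2
  -- hence the chart is `R` itself, and so is the transform
  have hblow : blowupRing R (x : K) = R := by
    refine le_antisymm (Subring.closure_le.mpr ?_) (le_blowupRing R _)
    rintro t (ht | ⟨y, hy, rfl⟩)
    · exact ht
    · exact hdiv y hy
  rw [hR₁, hblow, locAtCentre_eq_self_of_dominates hdom]

/-- In a DVR `R ≤ O` dominated by `O`: a non-zero `f ∈ R` divides a power of every `x ∈ 𝔪_R`, `f · s = x^m` with `s ∈ R`. [folklore] -/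
theorem exists_mul_eq_pow_of_isDiscreteValuationRing {R : Subring K} [IsDiscreteValuationRing R]
    {f x : R} (hf : f ≠ 0) (hx : x ∈ maximalIdeal R) :
    ∃ (m : ℕ) (s : K), s ∈ R ∧ (f : K) * s = (x : K) ^ m := by
  classical
  obtain ⟨ϖ, hϖ⟩ := IsDiscreteValuationRing.exists_irreducible R
  obtain ⟨a, hfa⟩ := IsDiscreteValuationRing.associated_pow_irreducible hf hϖ
  by_cases hx0 : x = 0
  · refine ⟨1, 0, R.zero_mem, ?_⟩
    rw [hx0, ZeroMemClass.coe_zero, pow_one, mul_zero]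
  obtain ⟨b, hxb⟩ := IsDiscreteValuationRing.associated_pow_irreducible hx0 hϖ
  have hb : 1 ≤ b := by
    by_contra hb0
    have hb0' : b = 0 := by omega
    rw [hb0', pow_zero] at hxb
    exact hx (hxb.symm.isUnit isUnit_one)
  -- `x^a = ϖ^{ab}·unit` and `f = ϖ^a·unit`, `a ≤ ab` ⇒ `f ∣ x^a`
  have hdvd : f ∣ x ^ a := by
    have h1 : Associated (x ^ a) (ϖ ^ (b * a)) := by rw [pow_mul]; exact hxb.pow_pow
    have h2 : ϖ ^ a ∣ ϖ ^ (b * a) := pow_dvd_pow ϖ (by nlinarith)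
    exact (hfa.dvd.trans h2).trans h1.symm.dvd
  obtain ⟨s, hs⟩ := hdvd
  refine ⟨a, (s : K), s.2, ?_⟩
  rw [← Subring.coe_mul, ← hs, SubmonoidClass.coe_pow]

end Tail

/-! ## The point sequence with a low-dimensional member, and the literal L5 -/

section Main

variable {k K : Type} [Field k] [Field K] [Algebra k K]

/-- Regularity propagates along the point sequence. [folklore] -/
theorem isRegularLocalRing_of_pointSequence {O : ValuationSubring K} {A₀ : Subalgebra k K} {R : ℕ → Subring K}
    (h₀ : A₀.toSubring ≤ O.toSubring) (hreg : IsRegularLocalRing (Localization.AtPrime (Ideal.comap (Subring.inclusion h₀) (maximalIdeal O))))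
    (hR0 : R 0 = locAtCentre A₀.toSubring O) (hstep : ∀ i, IsQuadraticTransformAlong O (R i) (R (i + 1))) :
    ∀ i, IsRegularLocalRing (R i)
  | 0 => by rw [hR0]; exact (isRegularLocalRing_locAtCentre_iff h₀).mpr hreg
  | i + 1 => (hstep i).isRegularLocalRing_of_isRegularLocalRing (isRegularLocalRing_of_pointSequence h₀ hreg hR0 hstep i)

/-- **Constancy after a low-dimensional member**: if `R i₁` has Krull dimension `≤ 1` then `R j = R i₁` for every `j ≥ i₁`. [folklore] -/
theorem eq_of_le_of_ringKrullDim_le_one {O : ValuationSubring K} {A₀ : Subalgebra k K} {R : ℕ → Subring K}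
    (h₀ : A₀.toSubring ≤ O.toSubring) (hreg : IsRegularLocalRing (Localization.AtPrime (Ideal.comap (Subring.inclusion h₀) (maximalIdeal O))))
    (hR0 : R 0 = locAtCentre A₀.toSubring O) (hstep : ∀ i, IsQuadraticTransformAlong O (R i) (R (i + 1)))
    {i₁ : ℕ} (hdim : ringKrullDim (R i₁) ≤ 1) : ∀ j, i₁ ≤ j → R j = R i₁ := by
  have key : ∀ d : ℕ, R (i₁ + d) = R i₁ := by
    intro d
    induction d with
    | zero => rfl
    | succ d ih =>
      rw [Nat.add_succ]
      have hq := hstep (i₁ + d)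
      rw [ih] at hq
      haveI hregi : IsRegularLocalRing (R i₁) := isRegularLocalRing_of_pointSequence h₀ hreg hR0 hstep i₁
      exact eq_of_isQuadraticTransformAlong_of_isPrincipalIdealRing (isPrincipalIdealRing_of_ringKrullDim_le_one hdim)
        (dominated_of_pointSequence h₀ hR0 hstep i₁) hq
  intro j hj
  obtain ⟨d, rfl⟩ := Nat.exists_eq_add_of_le hj
  exact key d

/-- **The literal L5 `ResonanceAlternative` (binder-free form)** from the HLOST Noetherian-hull fact: the conclusion of idea-2's L5
VERBATIM (vocabulary unfolded) from L5's point-sequence / hull-parameter / far-element data, WITHOUT the Setting-3.1 dimension binder of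
p518428 — if some member has dimension `≤ 1` the Shannon extension is that DVR and no far element exists. CONDITIONAL on
`HeinzerEtAl2015NoetherianHullUFD` (`proof.conditional`). OURS. [cite: HeinzerEtAl2015, Thm. 4.1 (1)] -/
theorem resonanceAlternative_of_noetherianHullUFD (hT : HeinzerEtAl2015NoetherianHullUFD.{0}) (p : ℕ)
    (O : ValuationSubring K) (A₀ : Subalgebra k K) (h₀ : A₀.toSubring ≤ O.toSubring) (R : ℕ → Subring K) (x f : K)
    (hreg : IsRegularLocalRing (Localization.AtPrime (Ideal.comap (Subring.inclusion h₀) (maximalIdeal O))))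
    (hR : R 0 = locAtCentre A₀.toSubring O ∧ ∀ i, IsQuadraticTransformAlong O (R i) (R (i + 1)))
    (hx : (∃ (i : ℕ) (_ : IsLocalRing (R i)) (z : Fin 1 → R i), IsRsopPart z ∧ ((z 0 : R i) : K) = x) ∧
      ∀ a ∈ (⨆ i, R i : Subring K), O.valuation a < 1 → ∃ m : ℕ, a ^ m / x ∈ (⨆ i, R i : Subring K))
    (hf : f ∈ (⨆ i, R i : Subring K) ∧ f ≠ 0 ∧ ¬ ∃ (m : ℕ) (s : K), s ∈ (⨆ i, R i : Subring K) ∧ f * s = x ^ m) :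
    (∃ m u : K, m ∈ (⨆ i, R i : Subring K) ∧
        (u ∈ (⨆ i, R i : Subring K) ∧ u ≠ 0 ∧ ∃ (m : ℕ) (s : K), s ∈ (⨆ i, R i : Subring K) ∧ u * s = x ^ m) ∧
        ∃ j : ℤ, f = m ^ p * u * x ^ j) ∨
      (∃ (q g : K) (hq : q ∈ Subring.closure (((⨆ i, R i : Subring K) : Set K) ∪ {x⁻¹}))
        (hg : g ∈ Subring.closure (((⨆ i, R i : Subring K) : Set K) ∪ {x⁻¹})) (e : ℕ),
        (q ∈ (⨆ i, R i : Subring K) ∧ q ≠ 0 ∧ ¬ ∃ (m : ℕ) (s : K), s ∈ (⨆ i, R i : Subring K) ∧ q * s = x ^ m) ∧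
        Prime (⟨q, hq⟩ : Subring.closure (((⨆ i, R i : Subring K) : Set K) ∪ {x⁻¹})) ∧ ¬ p ∣ e ∧ f = q ^ e * g ∧
        ¬ (⟨q, hq⟩ : Subring.closure (((⨆ i, R i : Subring K) : Set K) ∪ {x⁻¹})) ∣
          (⟨g, hg⟩ : Subring.closure (((⨆ i, R i : Subring K) : Set K) ∪ {x⁻¹}))) := by
  classical
  by_cases hdim2 : ∀ i, (2 : WithBot ℕ∞) ≤ ringKrullDim (R i)
  · exact resonanceAlternative_of_noetherianHullUFD_of_dim hT p O A₀ h₀ R x f hreg hdim2 hR hx hf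
  · -- the degenerate tail: some member has dimension `≤ 1`
    exfalso
    obtain ⟨i₁, hi₁⟩ := not_forall.mp hdim2
    haveI hregi : IsRegularLocalRing (R i₁) := isRegularLocalRing_of_pointSequence h₀ hreg hR.1 hR.2 i₁
    have hdim : ringKrullDim (R i₁) ≤ 1 := by
      have hfin := (isRegularLocalRing_iff (R i₁)).mp hregi   -- spanFinrank 𝔪 = dim
      rw [← hfin] at hi₁ ⊢
      have : ¬ (2 : ℕ) ≤ (maximalIdeal (R i₁)).spanFinrank := fun h => hi₁ (by exact_mod_cast h)
      exact_mod_cast (show (maximalIdeal (R i₁)).spanFinrank ≤ 1 by omega)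
    have hconst := eq_of_le_of_ringKrullDim_le_one h₀ hreg hR.1 hR.2 hdim
    have hmono : Monotone R := monotone_nat_of_le_succ fun i => (hR.2 i).le
    -- the Shannon extension is `R i₁`
    have hS : (⨆ i, R i : Subring K) = R i₁ := by
      refine le_antisymm (iSup_le fun j => ?_) (le_iSup R i₁)
      rcases le_total j i₁ with hj | hj
      · exact hmono hj
      · exact (hconst j hj).le
    -- `R i₁` is a DVR (it has a quadratic transform, so it is not a field)
    haveI hPIR : IsPrincipalIdealRing (R i₁) := isPrincipalIdealRing_of_ringKrullDim_le_one hdim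
    obtain ⟨_, x₁, hx₁m, hx₁0, -, -⟩ := (hR.2 i₁).exists_eq_locAtCentre
    haveI : IsDiscreteValuationRing (R i₁) :=
      { toIsPrincipalIdealRing := hPIR
        toIsLocalRing := inferInstance
        not_a_field' := fun hbot => hx₁0 (by
          have : x₁ ∈ (⊥ : Ideal (R i₁)) := hbot ▸ hx₁m
          exact (Submodule.mem_bot (R i₁)).mp this) }
    -- `x` and `f` in `R i₁`; `x` is a non-unit there
    obtain ⟨⟨i₀, hloc₀, z, hz, hzx⟩, -⟩ := hx
    obtain ⟨hfS, hf0, hfnot⟩ := hf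
    have hxR : x ∈ R i₁ := by rw [← hS]; exact (le_iSup R i₀ : R i₀ ≤ ⨆ i, R i) (by rw [← hzx]; exact (z 0).2)
    have hfR : f ∈ R i₁ := by rw [← hS]; exact hfS
    have hdom₁ := dominated_of_pointSequence h₀ hR.1 hR.2 i₁
    have hvx : O.valuation x < 1 := by
      have hdom₀ := dominated_of_pointSequence h₀ hR.1 hR.2 i₀
      rw [← hzx]
      exact ((subringDominates_valuationSubring_iff hdom₀.1).mp hdom₀ (z 0)).mp (hz.mem_maximalIdeal 0)
    have hxm : (⟨x, hxR⟩ : R i₁) ∈ maximalIdeal (R i₁) :=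
      ((subringDominates_valuationSubring_iff hdom₁.1).mp hdom₁ ⟨x, hxR⟩).mpr hvx
    have hf0' : (⟨f, hfR⟩ : R i₁) ≠ 0 := fun h => hf0 (congrArg Subtype.val h)
    obtain ⟨m, s, hs, hmul⟩ := exists_mul_eq_pow_of_isDiscreteValuationRing hf0' hxm
    exact hfnot ⟨m, s, by rw [hS]; exact hs, hmul⟩

end Main

end Summit.ResolutionOfSingularities.ResolutionOfSingularities.Theorems.SwitchingDichotomy.Resonance

end
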